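import Mathlib
import HarnessLib
import Literature.MathematicalPhysics.StatisticalMechanics.RenormalisationMapCounting

/-!
# The degree of the remainder terms of the renormalisation map is at least two ([ABKM19] Theorem 6.8)

For the smallness bookkeeping of the Lipschitz estimate of `S_k` (RenormalisationMapSmallness,
RenormalisationMapSmallnessTerms) every remainder term of `GradientRG.nextKStep_sub_opC_eq`
indexed by `(X, X₁, Y)` must have degree `D = |X ∖ Y|_k + |𝓒(Y)| ≥ 2` (one small factor per block
of `X ∖ Y`, one per connected component of `Y`).  This file proves it for the index families of the
remainder:

* `one_le_card_blocks_of_nonempty`, `one_le_card_components`, `two_le_card_components_of_not_isConn`,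
  `card_components_le_card_blocks` — counting components against blocks;
* **`two_le_degree_of_ne_self`** — `X` a polymer with `|X|_k ≥ 2`, `Y ∈ 𝓟_k(X)`, `Y ≠ X`
  (the pieces `R(e^{−H}−1)^X`, `R[rest(X)]`, `(1−e^{−H̃})^X` of the large connected and of the
  disconnected preimages);
* **`two_le_degree_self_of_not_isConn`** — `Y = X` disconnected (the piece `R K(X) = R ∏_{𝓒(X)} K` of a
  disconnected preimage);
* **`two_le_degree_of_ssubset`** — `∅ ≠ X₁ ⊊ X`, `Y ∈ 𝓟_k(X ∖ X₁)` (the fourth remainder sum).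

Everything is proved; elementary.

## References
* S. Adams, S. Buchholz, R. Kotecký, S. Müller, arXiv:1910.13564, Theorem 6.8 and proof of Lemma 9.6
  ((9.36): every term of `K_{k+1} − C_kK` is of second order) [AdamsBuchholzKoteckyMuller2019].
-/

noncomputable section

namespace Literature.MathematicalPhysics.StatisticalMechanics.TorusPolymer

open scoped BigOperators Classical
open Finset
open Literature.Barriers.CriticalPhenomena.LongRangePhi4.Polymer
  (IsConn ConnIn comp components mem_comp mem_comp_self comp_eq_of_mem)

variable {d M : ℕ} [NeZero M]

/-- A non-empty set meets at least one block. [cite: AdamsBuchholzKoteckyMuller2019, Ch. 6.2] -/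
theorem one_le_card_blocks_of_nonempty (s : ℕ) {X : Finset (Fin d → ZMod M)} (hX : X.Nonempty) :
    1 ≤ (blocks s X).card := by
  obtain ⟨x, hx⟩ := hX
  exact card_pos.2 ⟨blockOf s x, mem_blocks.2 ⟨x, hx, rfl⟩⟩

omit [NeZero M] in
/-- A non-empty set has at least one connected component. [cite: AdamsBuchholzKoteckyMuller2019, Ch. 6.2] -/
theorem one_le_card_components {X : Finset (Fin d → ZMod M)} (hX : X.Nonempty) :
    1 ≤ (components X).card := by
  obtain ⟨x, hx⟩ := hX
  exact card_pos.2 ⟨comp X x, mem_image.2 ⟨x, hx, rfl⟩⟩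

omit [NeZero M] in
/-- **A non-empty disconnected set has at least two connected components.**
[cite: AdamsBuchholzKoteckyMuller2019, Ch. 6.2] -/
theorem two_le_card_components_of_not_isConn {X : Finset (Fin d → ZMod M)} (hX : X.Nonempty)
    (hnc : ¬ IsConn X) : 2 ≤ (components X).card := by
  have h : ∃ x ∈ X, ∃ y ∈ X, ¬ ConnIn X x y := by
    by_contra hcon
    push Not at hcon
    exact hnc ⟨hX, hcon⟩
  obtain ⟨x, hx, y, hy, hxy⟩ := h
  have hne : comp X x ≠ comp X y := by
    intro heq
    have : y ∈ comp X x := by rw [heq]; exact mem_comp_self hy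
    exact hxy (mem_comp.1 this).2
  have hsub : ({comp X x, comp X y} : Finset (Finset (Fin d → ZMod M))) ⊆ components X := by
    intro Z hZ
    rcases mem_insert.1 hZ with rfl | hZ
    · exact mem_image.2 ⟨x, hx, rfl⟩
    · rw [mem_singleton.1 hZ]; exact mem_image.2 ⟨y, hy, rfl⟩
  calc 2 = ({comp X x, comp X y} : Finset (Finset (Fin d → ZMod M))).card := (card_pair hne).symm
    _ ≤ (components X).card := card_le_card hsub

/-- **`|𝓒(Y)| ≤ |Y|_k`**: every connected component of a polymer contains a block.
[cite: AdamsBuchholzKoteckyMuller2019, Ch. 6.2] -/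
theorem card_components_le_card_blocks (hMo : Odd M) {s : ℕ} (hs : Odd s) {Y : Finset (Fin d → ZMod M)}
    (hY : IsPolymer s Y) : (components Y).card ≤ (blocks s Y).card := by
  rw [card_blocks_eq_sum_components hMo hs hY, card_eq_sum_ones]
  refine sum_le_sum fun Z hZ => ?_
  obtain ⟨-, hZc⟩ := hY.of_mem_components hMo hs hZ
  exact one_le_card_blocks_of_nonempty s hZc.1

/-- **Degree `≥ 2` away from the top**: for a `k`-polymer `X` with `|X|_k ≥ 2` and `Y ∈ 𝓟_k(X)`,
`Y ≠ X`: `|X ∖ Y|_k + |𝓒(Y)| ≥ 2`. [cite: AdamsBuchholzKoteckyMuller2019, Theorem 6.8 / proof of Lemma 9.6 (9.36)] -/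
theorem two_le_degree_of_ne_self {s : ℕ} {X Y : Finset (Fin d → ZMod M)} (hX : IsPolymer s X)
    (h2 : 2 ≤ (blocks s X).card) (hY : Y ∈ polys s X) (hYX : Y ≠ X) :
    2 ≤ (blocks s (X \ Y)).card + (components Y).card := by
  obtain ⟨hYsub, hYp⟩ := mem_polys.1 hY
  have hsplit := card_blocks_eq_add_sdiff hX hY
  rcases Y.eq_empty_or_nonempty with rfl | hYne
  · rw [sdiff_empty]; omega
  · have h1 := one_le_card_components hYne
    have hne : (X \ Y).Nonempty := by
      rw [sdiff_nonempty]; exact fun h => hYX (Subset.antisymm hYsub h)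
    have h2' := one_le_card_blocks_of_nonempty s hne
    omega

/-- **Degree `≥ 2` at the top of a disconnected preimage**: `Y = X` non-empty and not connected has
`|X ∖ X|_k + |𝓒(X)| = |𝓒(X)| ≥ 2`. [cite: AdamsBuchholzKoteckyMuller2019, Theorem 6.8 / proof of Lemma 9.6 (9.36)] -/
theorem two_le_degree_self_of_not_isConn (s : ℕ) {X : Finset (Fin d → ZMod M)} (hX : X.Nonempty)
    (hnc : ¬ IsConn X) : 2 ≤ (blocks s (X \ X)).card + (components X).card :=
  le_add_left (two_le_card_components_of_not_isConn hX hnc)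

/-- A non-empty disconnected polymer has at least two blocks.
[cite: AdamsBuchholzKoteckyMuller2019, Ch. 6.2] -/
theorem two_le_card_blocks_of_not_isConn (hMo : Odd M) {s : ℕ} (hs : Odd s) {X : Finset (Fin d → ZMod M)}
    (hX : IsPolymer s X) (hne : X.Nonempty) (hnc : ¬ IsConn X) : 2 ≤ (blocks s X).card :=
  (two_le_card_components_of_not_isConn hne hnc).trans (card_components_le_card_blocks hMo hs hX)

/-- **Degree `≥ 2` for the fourth remainder sum**: for polymers `∅ ≠ X₁ ⊊ X` (`X₁ ∈ 𝓟_k(X)`) and every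
`Y ∈ 𝓟_k(X ∖ X₁)`: `|X ∖ Y|_k + |𝓒(Y)| ≥ 2`.
[cite: AdamsBuchholzKoteckyMuller2019, Theorem 6.8 / proof of Lemma 9.6 (9.36)] -/
theorem two_le_degree_of_ssubset {s : ℕ} {X X₁ Y : Finset (Fin d → ZMod M)} (hX : IsPolymer s X)
    (hX₁ : X₁ ∈ polys s X) (hX₁ne : X₁.Nonempty) (hX₁X : X₁ ≠ X) (hY : Y ∈ polys s (X \ X₁)) :
    2 ≤ (blocks s (X \ Y)).card + (components Y).card := by
  obtain ⟨hX₁sub, hX₁p⟩ := mem_polys.1 hX₁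
  obtain ⟨hYsub, hYp⟩ := mem_polys.1 hY
  have hsplit := card_blocks_eq_add_sdiff hX hX₁
  have h1 := one_le_card_blocks_of_nonempty s hX₁ne
  have hne : (X \ X₁).Nonempty := by
    rw [sdiff_nonempty]; exact fun h => hX₁X (Subset.antisymm hX₁sub h)
  have h2 := one_le_card_blocks_of_nonempty s hne
  have hYX : Y ∈ polys s X := mem_polys.2 ⟨hYsub.trans sdiff_subset, hYp⟩
  refine two_le_degree_of_ne_self hX (by omega) hYX ?_
  rintro rfl
  obtain ⟨x, hx⟩ := hX₁ne
  exact (mem_sdiff.1 (hYsub (hX₁sub hx))).2 hx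

end Literature.MathematicalPhysics.StatisticalMechanics.TorusPolymer

end
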